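import Mathlib
import Literature.NumberTheory.Transcendental.KZCalculus
import Literature.NumberTheory.Transcendental.KZLogCalculusProofs
import Literature.NumberTheory.Transcendental.KZProductIdeal
import Summits.KontsevichZagierPeriods.KontsevichZagierPeriods.Theses.UnfoldedStokes

/-!
# `HyperellipticRiemannRelation` (stmt-KontsevichZagierPeriods-3522), line `SketchIdeator2`:
# stub `stub_swapGlue` — antisymmetrisation glue (rules 1b, 2)

Registered stub `stub_swapGlue` of the line skeleton. On a box `(a,b) × (c,d)` the crux integrand
`g(x₀,x₁) = (x₁ − x₀)/√(|P(x₀)||P(x₁)|)`, `P(t) = ∏_{i<5} (t − eᵢ)`, is `f − f ∘ swap` with the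
ORDERED integrand `f(x₀,x₁) = x₁/√(|P(x₀)||P(x₁)|)` and `swap (x₀,x₁) = (x₁,x₀)` — pointwise for
every `x` (the root `√(|P(x₀)||P(x₁)|)` is symmetric; no positivity is needed since `y/0 = 0`).
Given representations `r = [(a,b)×(c,d), g]`, `p = [(a,b)×(c,d), f]`, `p' = [(c,d)×(a,b), f]`:

* the swapped ordered box `q = p'.reindex (0 1) = [(a,b)×(c,d), f ∘ swap]` is ONE rule-2 move away
  from `p'` (`KZ.of_sub_of_reindex_mem_relations`: a coordinate permutation, `|det| = 1`);
* `[r] − [p] − [q.neg]` is ONE rule-1b move (`KZ.integrandAddRel`: `g = f + (−f ∘ swap)` on the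
  common domain);
* `[q] + [q.neg]` is a relation (`KZ.of_add_of_mem_relations_of_eqOn_neg`);

and `[r] − [p] + [p'] = ([r] − [p] − [q.neg]) + ([q] + [q.neg]) + ([p'] − [q])` in the free abelian
group. No definitions are introduced.
References: Kontsevich–Zagier 2001, §1.2 rules (1), (2).
-/

noncomputable section

namespace Summit.KontsevichZagierPeriods.UnfoldedStokes.HyperellipticRiemannRelationLine

open Set MeasureTheory Filter Topology
open Literature.NumberTheory.Transcendental
open Literature.ModelTheory.ExponentialFields (IsSemialgebraic)

namespace SwapGlue

/-- The pointwise antisymmetrisation identity behind rule 1b: with a symmetric root in the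
denominator, `(u − v)/√(AB) = u/√(AB) + (−(v/√(BA)))`. [folklore] -/
theorem sub_div_sqrt_mul_comm (u v A B : ℝ) :
    (u - v) / Real.sqrt (A * B) = u / Real.sqrt (A * B) + -(v / Real.sqrt (B * A)) := by
  rw [mul_comm B A, sub_div, sub_eq_add_neg]

/-- The box `(a,b) × (c,d)` written with `Ioo` is the box written with four inequalities.
[folklore] -/
theorem setOf_mem_Ioo_and_eq (a b c d : ℝ) :
    {x : Fin 2 → ℝ | x 0 ∈ Ioo a b ∧ x 1 ∈ Ioo c d} =
      {x | a < x 0 ∧ x 0 < b ∧ c < x 1 ∧ x 1 < d} := by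
  ext x
  simp only [mem_setOf_eq, mem_Ioo, and_assoc]

/-- The coordinate swap (reindexing along the transposition `(0 1)`) carries the transposed box
`(c,d) × (a,b)` back to `(a,b) × (c,d)`. [folklore] -/
theorem reindex_swap_domain_eq (a b c d : ℝ) (p' : KZ.IntegralRep 2)
    (hp'd : p'.domain = {x | x 0 ∈ Ioo c d ∧ x 1 ∈ Ioo a b}) :
    (p'.reindex (Equiv.swap (0 : Fin 2) 1)).domain =
      {x | a < x 0 ∧ x 0 < b ∧ c < x 1 ∧ x 1 < d} := by
  rw [KZ.IntegralRep.reindex_domain, hp'd]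
  ext x
  simp only [mem_setOf_eq, mem_Ioo, Equiv.swap_apply_left, Equiv.swap_apply_right]
  tauto

end SwapGlue

/-! ## The registered stub -/

/-- **Swap glue.** On a box `(a,b) × (c,d)` the crux integrand
`g = (x₁ − x₀)/√(|P(x₀)||P(x₁)|)` is `f − f∘swap`, `f = x₁/√(|P(x₀)||P(x₁)|)` (rule 1b), and
`[(a,b)×(c,d), f∘swap] ∼ [(c,d)×(a,b), f]` by the coordinate swap (rule 2, `|det| = 1`): so
`[r] − [p] + [p′] ∈ relations` for any representations `r` (crux box), `p` (ordered box) and `p′`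
(transposed ordered box). [cite: KontsevichZagier2001, §1.2 rules (1), (2)] -/
theorem stub_swapGlue :
    ∀ (e : Fin 5 → ℚ) (a b c d : ℝ) (r p p' : KZ.IntegralRep 2),
      r.domain = {x | a < x 0 ∧ x 0 < b ∧ c < x 1 ∧ x 1 < d} →
      EqOn r.integrand (fun x => (x 1 - x 0) /
        Real.sqrt (|∏ i : Fin 5, (x 0 - (e i : ℝ))| * |∏ i : Fin 5, (x 1 - (e i : ℝ))|)) r.domain →
      p.domain = {x | x 0 ∈ Ioo a b ∧ x 1 ∈ Ioo c d} →
      (p.integrand = fun x => x 1 /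
        Real.sqrt (|∏ i : Fin 5, (x 0 - (e i : ℝ))| * |∏ i : Fin 5, (x 1 - (e i : ℝ))|)) →
      p'.domain = {x | x 0 ∈ Ioo c d ∧ x 1 ∈ Ioo a b} →
      (p'.integrand = fun x => x 1 /
        Real.sqrt (|∏ i : Fin 5, (x 0 - (e i : ℝ))| * |∏ i : Fin 5, (x 1 - (e i : ℝ))|)) →
      KZ.of r - KZ.of p + KZ.of p' ∈ KZ.relations := by
  intro e a b c d r p p' hrd hri hpd hpi hp'd hp'i
  -- the swapped ordered box `q = [(a,b)×(c,d), f ∘ swap]`, one rule-2 move away from `p'`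
  set q : KZ.IntegralRep 2 := p'.reindex (Equiv.swap (0 : Fin 2) 1) with hq
  have hpd' : p.domain = r.domain := by
    rw [hrd, hpd]
    exact SwapGlue.setOf_mem_Ioo_and_eq a b c d
  have hqd : q.neg.domain = r.domain := by
    rw [KZ.IntegralRep.domain_neg, hrd, hq]
    exact SwapGlue.reindex_swap_domain_eq a b c d p' hp'd
  -- rule 1b: `g = f + (−f ∘ swap)` on the common domain
  have h1 : KZ.of r - KZ.of p - KZ.of q.neg ∈ KZ.relations := by
    refine KZ.integrandAddRel_subset_relations ⟨2, r, p, q.neg, hpd', hqd, ?_, rfl⟩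
    intro x hx
    rw [hri hx]
    simp only [hpi, hq, KZ.IntegralRep.reindex_integrand, hp'i, KZ.IntegralRep.integrand_neg,
      Pi.add_apply, Pi.neg_apply, Equiv.swap_apply_left, Equiv.swap_apply_right]
    exact SwapGlue.sub_div_sqrt_mul_comm _ _ _ _
  -- `[q] + [q.neg]` is a relation
  have h2 : KZ.of q + KZ.of q.neg ∈ KZ.relations :=
    KZ.of_add_of_mem_relations_of_eqOn_neg (KZ.IntegralRep.domain_neg q) fun _ _ => rfl
  -- rule 2: the coordinate swap `[p'] − [q]`
  have h3 : KZ.of p' - KZ.of q ∈ KZ.relations :=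
    KZ.of_sub_of_reindex_mem_relations p' (Equiv.swap (0 : Fin 2) 1)
  have key : KZ.of r - KZ.of p + KZ.of p' =
      (KZ.of r - KZ.of p - KZ.of q.neg) + (KZ.of q + KZ.of q.neg) + (KZ.of p' - KZ.of q) := by
    abel
  rw [key]
  exact KZ.relations.add_mem (KZ.relations.add_mem h1 h2) h3

end Summit.KontsevichZagierPeriods.UnfoldedStokes.HyperellipticRiemannRelationLine
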